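import Summits.QuantumFields.YangMills.Theorems.BalabanUVNodesN22AtRateRecord13Fixed
import Summits.QuantumFields.YangMills.Theorems.BalabanUVNodesRateCarriersOfRecord13Sep
import Summits.QuantumFields.YangMills.Theorems.BalabanUVNodesN22AtRateRecord12Fixed

/-!
# ⁗ (SEPARATION-GUARD) EDITION of 9″b `BalabanUVNodesN22AtRateRecord13Fixed` (p494520) — «`FadingMemory` by name from a modulus» AT THE RECORD (θ-form consumers of the ‴ level lemmas) and the W1 object ROAD 1 at the record.
#
# WHY THIS FILE EXISTS (route `route-QuantumFields-BalabanUVNodes` rev 18; director-ym LINE №136–№138, plan g67 ACK-138, dag-lead WORDS-139∕140, pub-ymgap INBOX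
# l.16256 ∕ l.16518 ∕ l.16567 ∕ l.16541).  def-P11 LOCATED that `Stage13Params.Provisos₁₃.bg` demanded the background-row conclusion at EVERY (2.18)-sequence, where
# print ([Balaban1989LargeFieldII] Thm 1) gives it only at SEPARATED sequences; the gate refuses a same-name in-place body change (D-0009), so def-T's `Node00/Record13`
# v1.2 (p501191) ADDED the print-faithful proviso `Stage13Params.Provisos₁₃Sep` (support guard via `Sect2.SeqSeparated`) with its datum `Node00.datumOfRecord₁₃Sep` (`= datumOfRecord₁₃`
# on the old provisos by `rfl`), RR-2 re-keyed the datum key (`Node00/Record13DatumKeySep`, p502881: `IsDatumOfRecord₁₃CSep ∕ COn ∕ CN`, `IsRecordOfRecord₁₃CSep…`), and the four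
# cruxes were re-minted ⁗ over the new tokens (K3⁗ `SpineGivenEndpointR13Sep`).  A proof of the WEAKER new proviso cannot feed a theorem binding the old one, so every
# storey typed `∀ θ (hP : θ.Provisos₁₃ F N), …` is re-keyed ONCE; this file is the (T-RATE) pen's twin of its own ‴ module under the token map
# `Provisos₁₃ ↦ Provisos₁₃Sep` · `datumOfRecord₁₃ ↦ datumOfRecord₁₃Sep` · `(Is|is)DatumOfRecord₁₃C… ↦ …₁₃CSep…` · `(Is|is)RecordOfRecord₁₃C… ↦ …₁₃CSep…` and, for THIS seat's
# names, `₁₃ ↦ ₁₃Sep` inserted in the stage-KEYED stems only (`RateReading₁₃`, `rateCarriersOfRecord₁₃`, `RRec₁₃(On)`, `rRec₁₃…`, `readingOfRecord₁₃`, `…datumKey₁₃…`,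
# `n22_tupleReadingOfRecord(On)…`).  EVERYTHING θ-LEVEL IS UNCHANGED AND NOT RE-DECLARED: `Stage13Params`, `u3OfRecord₁₃ θ u k` and its faces, the θ-form slot ∕ edge
# closers `n22At_u3OfRecord₁₃_…` of the ‴ modules carry no proviso and are IMPORTED BY NAME (this module imports its ‴ original) — here: `n22At_u3OfRecord₁₃_of_ne9_le`, `n22At_u3OfRecord₁₃_of_ne9_fading`, `n22At_u3OfRecord₁₃_ofFixed_iff`, `n22At_u3OfRecord₁₃_ofFixed_of_ne9_fading`, `n22At_u3OfRecord₁₃_w1_of_youngLipschitz`, `n22At_u3OfRecord₁₃_w1Functional_of_youngLipschitz`, `n22At_u3OfRecord₁₃_of_w1Level`.  Statements = the ‴ statements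
# under the map, proofs = the ‴ proofs verbatim (kernel re-derivations BY NAME); the ‴ module stays in the tree as the aside items' context.  bg-BLIND: like its
# original, nothing here reads any field of the proviso — it enters only as the binder TYPE of the readings and through RR-2's key.
#
# ITEM IDS: crux names ∕ item ids quoted in the ‴ header below (K0‴–K3‴ = stmt-QuantumFields-19909…19912, `Record13Inhabited`, `SpineGivenEndpointR13`) are the
# rev-16∕17 ones, ASIDES after rev 18; this file is filed `--supports stmt-QuantumFields-20292` (K3⁗ `SpineGivenEndpointR13Sep` per plan's KEY line ∕ dag-lead WORDS-140) as a HELPER —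
# count-neutral, no stub closed, N22 NOT discharged, no inhabitant of any ⁗ key claimed (K0⁗ `Record13SepInhabited` OPEN).
#
# ‴ HEADER OF RECORD FOLLOWS (token-mapped; its decl lists are this file's, the θ-only names above excepted):
#
# BalabanUVNodes ∕ node N22 — «`FadingMemory` BY NAME FROM A MODULUS» AT THE STAGE-13 HOME, and THE W1 OBJECT READ AT THE STAGE-13 RATE-RECORD HOME:
# `N22At (u3OfRecord₁₃ θ u k)` from NE9 of the level-`k` functional in ANY fading modulus table (monotonicity in the moduli), the fixed-carrier reading
# `U3Objects₁₁.ofFixed`, and node00-def-W1's history functional `W1.functionalOn S p emb` on `W1.histCarriers` with dag-n22-c's ROAD-1 estimate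
# (`YoungLipschitz` + `Bound238` ⟹ NE9, `…N22W1YoungLipschitz`) plugged in — node N22's stub `S_N22 (RRec₁₃Sep 𝔯)` for every Stage-13 reading whose level bundles are the W1
# object's, modulo the displayed (2.38)-type hypotheses on W1's cluster tower

Track A of `YM-PLAN.md` (cell `pub-ymgap`, HUMAN RULING D-0062), R134 seat `pub-ymgap-dag-n22-e` (s2 «`FadingMemory` by name from a modulus + knit at the record»), gen 5,
module 9″b = the Stage-13 twin (`12 ↦ 13`) of the lineage's module 3 `…N22AtRateRecord12Fixed.lean` (p466571) at the record OF RECORD (director-ym LINE №125 ∕ №133; route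
rev 16 ∕ 17, K3‴ `SpineGivenEndpointR13` = stmt-QuantumFields-19912; dag-lead WORDS-133 ∕ 134 ∕ 135).  THEOREMS ONLY, every proof one application by name; imports layer B at ₁₃
(`…RateCarriersOfRecord13`) and module 3 (for the stage-free `ne9_of_moduli_le` and n22-c's `…N22W1YoungLipschitz` ∕ W1's `HistoryTermsOfRecord` it brings — reused, not
re-declared); restate-immune (no Theses import); COUNT-NEUTRAL; `--supports` K3‴ (stmt-QuantumFields-19912) as a helper.

WHAT IS KERNEL-CHECKED ([folklore]; 0 `def`, 0 `sorry`; the Stage-12 list under `12 ↦ 13`).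
* §1 `n22At_u3OfRecord₁₃_of_ne9_le` · `n22At_u3OfRecord₁₃_of_ne9_fading` (**`FadingMemory` BY NAME from a modulus** at the Stage-13 bundle, any `u : U3Objects₁₁`) · fixed-carrier
  faces `n22At_u3OfRecord₁₃_ofFixed_iff` ∕ `_ofFixed_of_ne9_fading`.
* §2 `s_N22_rRec₁₃Sep_of_ne9_fading` (θ-form at the record).
* §3 THE W1 OBJECT at the bundle, ROAD 1: `n22At_u3OfRecord₁₃_w1_of_youngLipschitz` · `n22At_u3OfRecord₁₃_w1Functional_of_youngLipschitz` · `n22At_u3OfRecord₁₃_of_w1Level`.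
* §4 THE W1 OBJECT at the record: `s_N22_rRec₁₃Sep_of_w1`.

HONEST FRAMING.  Hypothesis-schema bookkeeping: `YoungLipschitz`, `Bound238`, the fading table, the space tables and the numerals are DISPLAYED hypotheses with NO producer in
the tree; W1's cluster tower `S` is residual DATA; nothing of Bałaban's is asserted or instantiated — NE9 is NOT PRINTED for d = 4 and NOT PROVED, (2.40)–(2.41) NOT PROVED;
no inhabitant of `IsDatumOfRecord₁₃CSep` claimed (K0‴ `Record13Inhabited`, stmt-QuantumFields-19909, OPEN); N22 NOT discharged; counts UNMOVED (typed 28∕28 · discharged 5∕27,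
A 5∕28); one finite four-torus programme at fixed `ε` — NOT ℝ⁴, NOT infinite volume, NOT OS, NOT a mass gap, NOT Clay.  No decl below carries a cite tag.
-/

noncomputable section

namespace YMDAG.N22

open Set Metric
open scoped BigOperators
open Literature.MathematicalPhysics.QuantumFieldTheory.Balaban1983to89
open Literature.MathematicalPhysics.QuantumFieldTheory.Balaban1983to89.T4Continuum
open Literature.MathematicalPhysics.QuantumFieldTheory.Balaban1983to89.T4OutputRate
open Literature.MathematicalPhysics.QuantumFieldTheory.Balaban1983to89.B12TreeDecay (K₀)
open Literature.MathematicalPhysics.QuantumFieldTheory.Balaban1983to89.Node00 (Stage13Params IsDatumOfRecord₁₃CSep U3Objects₁₁ U3Letters₁₁)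
open Literature.MathematicalPhysics.QuantumFieldTheory.Balaban1983to89.Node00.Sect2 (domSys CPair ofBackgroundC)
open Literature.MathematicalPhysics.QuantumFieldTheory.Balaban1983to89.Node00.W1 (RunPairing histCarriers ClusterTower functionalOn functional box)
open YMDAG.UVSplit

variable {N : ℕ} [NeZero N]

/-! ## §2 … and at the record: `S_N22 (RRec₁₃Sep 𝔯)` from NE9 of every level functional in a fading table (θ-form) -/

section Record

variable (𝔯 : RateReading₁₃Sep N)

/-- **`S_N22 (RRec₁₃Sep 𝔯)` FROM NE9 IN A FADING TABLE, θ-FORM** («`FadingMemory` by name from a modulus» at the record): if at every admissible Stage-13 tuple with provisos,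
every `(g₀, os)` and run length `k`, the reading's U3 objects carry their signs and the level functional `(𝔯.lit F θ hP g₀ os).u3.EA k` has NE9 on `]0, θ.γ]` with the block's
decay in SOME table fading at the block's rate `ω` with amplitude `≤` the block's `C₉`, then node N22's stub holds at the Stage-13 home. [folklore] -/
theorem s_N22_rRec₁₃Sep_of_ne9_fading
    (h9 : ∀ (F : T4Family) (θ : Stage13Params F N) (hP : θ.Provisos₁₃Sep F N), θ.Admissible F N → ∀ (g₀ : ℕ → ℝ) (os : List (ULoop F)) (k : ℕ),
      (𝔯.lit F θ hP g₀ os).u3.Signs ∧ ∃ (Λ : ℕ → ℕ → ℝ) (C₉ : ℝ),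
        NE9 ((𝔯.lit F θ hP g₀ os).u3.EA k) (Window θ.γ) (𝔯.lit F θ hP g₀ os).u3.κ Λ ∧ FadingMemory C₉ (𝔯.lit F θ hP g₀ os).u3.ω Λ ∧
          C₉ ≤ (𝔯.lit F θ hP g₀ os).u3.C₉) :
    S_N22 (RRec₁₃Sep 𝔯) := by
  rw [s_N22_rRec₁₃Sep_iff]
  intro F D h g₀ os k
  obtain ⟨hs, Λ, C₉, hne9, hfade, hC₉⟩ := h9 F h.params h.provisos h.admissible g₀ os k
  exact n22At_u3OfRecord₁₃_of_ne9_fading h.params _ k hs hne9 hfade hC₉ rfl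

end Record

/-! ## §4 THE W1 OBJECT at the record: `S_N22 (RRec₁₃Sep 𝔯)` for a reading whose bundles are the W1 object's, ROAD 1 -/

section W1Record

variable (𝔯 : RateReading₁₃Sep N) {𝔸 : Type*}

open Classical in
/-- **`S_N22 (RRec₁₃Sep 𝔯)` FOR A STAGE-13 READING WHOSE LEVEL BUNDLES ARE THE W1 OBJECT's, ROAD 1.**  If at every admissible Stage-13 tuple with provisos, every `(g₀, os)` AND
EVERY RUN LENGTH `k`, the reading's level-`k` bundle IS the level-`k` bundle of `ofFixed (W1.histCarriers (F.P K) M p) (W1.functionalOn S p emb) EB ℓ` for SOME W1 data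
(torus `K` — node00-def-W1 g2 takes the `k`-th one —, cube side `M`, cluster tower `S`, pairing `p`, reading map `emb`, family `EB`, letter block `ℓ`; `rfl` for W1's reading)
carrying §3's displayed hypotheses (space tables, `Bound238`, `YoungLipschitz` with a fading table on the boxes of `θ.γ`, n22-c's numerals, the letter signs and
inequalities), then node N22's stub holds at the Stage-13 home — where node00-def-W1's NAMED reading and n22-c's estimate MEET. [folklore] -/
theorem s_N22_rRec₁₃Sep_of_w1
    (hw1 : ∀ (F : T4Family) (θ : Stage13Params F N) (hP : θ.Provisos₁₃Sep F N), θ.Admissible F N → ∀ (g₀ : ℕ → ℝ) (os : List (ULoop F)) (k : ℕ),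
      ∃ (K M : ℕ) (S : ClusterTower (F.P K) 𝔸 M) (p : RunPairing) (emb : p.BgA → CPair (F.P K) 𝔸)
        (EB : ℝ → Functional (histCarriers (F.P K) M p) (histCarriers (F.P K) M p).BgB) (ℓ : U3Letters₁₁)
        (sp : (j : ℕ) → (domSys (F.P K) M (j + 1)).Dom → Set (CPair (F.P K) 𝔸)) (A R r₁ C₉ ω : ℝ) (ℓtab : ℕ → ℕ → ℝ),
        u3OfRecord₁₃ θ (𝔯.lit F θ hP g₀ os).u3 k = u3OfRecord₁₃ θ (U3Objects₁₁.ofFixed (histCarriers (F.P K) M p) (functionalOn S p emb) EB ℓ) k ∧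
        (∀ (j : ℕ) (U : p.BgA) Z, emb U ∈ sp j Z) ∧ 0 < A ∧ 0 ≤ r₁ ∧ ℓ.κ ≤ r₁ ∧ r₁ + 2 * (64 * Real.log 162) + 2 ≤ R ∧
        2 * A * Real.exp (5 * r₁ + 1) * K₀ 64 8 * 9 * 64 ≤ 1 ∧ FadingMemory C₉ ω ℓtab ∧
        (∀ j, (S j).Bound238 (box θ.γ j) (sp j) A R) ∧ (∀ j, (S j).YoungLipschitz (box θ.γ j) (sp j) (fun i : Fin (j + 1) => ℓtab (j + 1) i) R) ∧
        ℓ.Signs ∧ ω = ℓ.ω ∧ 8 * (Real.exp 1 * 9 * 64 * K₀ 64 8 ^ 2) * C₉ ≤ ℓ.C₉) :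
    S_N22 (RRec₁₃Sep 𝔯) := by
  rw [s_N22_rRec₁₃Sep_iff]
  intro F D h g₀ os k
  obtain ⟨K, M, S, p, emb, EB, ℓ, sp, A, R, r₁, C₉, ω, ℓtab, hu, hsp, hA, hr₁, hκ, hrate, hsmall, hfade, h238, hYL, hs, hω, hC₉⟩ :=
    hw1 F h.params h.provisos h.admissible g₀ os k
  exact n22At_u3OfRecord₁₃_of_w1Level F h.params K _ k S p emb EB ℓ hu sp hsp ℓtab hA hr₁ hκ hrate hsmall hfade h238 hYL hs hω hC₉

end W1Record

end YMDAG.N22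

end
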